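import Literature.NumberTheory.Automorphic.AdelicAdditiveCharacter
import Literature.NumberTheory.Automorphic.AdelicSecondCountable
import Literature.NumberTheory.Automorphic.AdicCompletionLocalField
import Mathlib.MeasureTheory.Measure.Haar.Unique
import Mathlib.MeasureTheory.Integral.Prod
import HarnessLib

/-!
# `X(𝔸_K) = X(K_v) × X(𝔸_K)^{(v)}` for the adelic vector space `X(𝔸_K) = 𝔸_K^ι`: splitting off one
# finite place as a topological group, and the factorisation of the Haar measure

Topic `NumberTheory/Automorphic`; namespace `Literature.NumberTheory.Automorphic.AdelicVector`.  Four
definitions with bodies (`evalAt`, `single`, `trivialAt`, `placeSplitting`) and theorems; no named fact,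
no instance, no `sorry`.

For a number field `K`, a finite index type `ι` and a finite place `v` of `K` the additive group
`X(𝔸_K) := ι → 𝔸_K` (`𝔸_K = AdeleRing (𝓞 K) K`, Mathlib) is the INTERNAL direct sum of its `v`-component
`X(K_v) := ι → K_v` (embedded by the factor inclusion `adeleSingleHom K v : K_v → 𝔸_K` of the tree,
coordinatewise) and of the CLOSED subgroup `X(𝔸_K)^{(v)} := trivialAt = {x | (x i)_v = 0 ∀ i}` of vectors
trivial at `v` — exactly as the tree does it for `GL_n(𝔸_K)` in `GLnPlaceSplitting` (`GLn.placeSplitting`,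
no restricted product over the places `w ≠ v` is built).  This is the «restricted-product splitting
`X(𝔸) ≃ X(K_v) × X(𝔸^{(v)})` as measure spaces» of A. Weil, *Acta Math.* 113 (1965), n° 51 (proof of
Thm. 4, pp. 73–74: the auxiliary place `v`, `X_A = X_v × X'`), in the generality of Bump (1997) §3.3,
Prop. 3.3.2 / Cassels–Fröhlich (1967) Ch. II §14 (`𝔸 = K_v × 𝔸^{(v)}` componentwise, Haar measure =
product of the local Haar measure and a Haar measure of the complement).

* §1 `evalAt K ι v : X(𝔸_K) →+ X(K_v)` (`x ↦ ((x i)_v)_i`, continuous) and `single K ι v : X(K_v) →+ X(𝔸_K)`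
  (`a ↦ (ι_v(a i))_i`, continuous), `evalAt ∘ single = id`, `evalAt_w ∘ single_v = 0` (`w ≠ v`), the
  archimedean components of `single a` vanish;
* §2 `trivialAt K ι v = ker evalAt` (closed), **`placeSplitting K ι v : X(K_v) × trivialAt ≃ₜ+ X(𝔸_K)`**,
  `(a, h) ↦ single a + h`, inverse `x ↦ (x_v, x − single x_v)`;
* §3 point-set facts bound locally (`X(𝔸_K)`, `X(K_v)`, `trivialAt` are Hausdorff, second countable, locally
  compact, σ-compact — from the tree's `secondCountableTopology_adeleRing`, `locallyCompactSpace_adeleRing'`,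
  `AdicCompletionLocalField`);
* §4 **`exists_map_placeSplitting_symm_eq_smul_prod`** — for additive Haar measures `ν` on `X(𝔸_K)`, `μ_v` on
  `X(K_v)` and `μ'` on `trivialAt` there is `κ > 0` with `(placeSplitting⁻¹)_* ν = κ • (μ_v ⊗ μ')` (uniqueness of
  Haar measure on the product group), with the Tonelli form `exists_lintegral_eq_mul_lintegral_lintegral` and the
  Bochner form `exists_integral_eq_smul_integral_prod` (one `κ` for all integrands); measures finite on compacts
  stay so when transported along the splitting (`isFiniteMeasureOnCompacts_map_placeSplitting_symm`);
* §5 MATRIX ACTIONS: `evalAt (A *ᵥ x) = A_v *ᵥ evalAt x` for every `A ∈ M_ι(𝔸_K)` (`A_v := A.map (adeleEval K v)`),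
  `A *ᵥ trivialAt ⊆ trivialAt`, and for `A` LOCAL AT `v` (`A_w = 1` for `w ≠ v`, archimedean part `1`; e.g. the
  tree's `GLn.ofLocal m K v g`): `A *ᵥ (single a + h) = single (A_v *ᵥ a) + h`, i.e.
  **`placeSplitting_symm_mulVec_of_isLocalAt`**: through the splitting `A` acts as `(A_v *ᵥ ·) × id`.

Road not taken: an EXTERNAL model `X(𝔸_K) ≃ X(K_v) × Πʳ_{w ≠ v} X(K_w) × X(K_∞)` through the tree's
restricted-product measure theory (`Literature/MeasureTheory/RestrictedProduct/*`: the cylinder product formula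
`ProdL2.measurePreserving_evalT`, the Haar uniqueness transfer `eq_smul_rpMeasure`) — not needed by the consumers,
which quantify over rectangles `A ×ˢ B` with `B` in a π-system of subsets of an arbitrary measurable space `Y`.

USE (cell `hodgecm-mathlib`, FLOOR-0 P4, ENGINE E-2 child `Cruxes/H413/Lines/F0_E2SiegelWeilWeilRange.lean`,
`StubSW2` (iii), I-CLOSE sheet `SW2-ICLOSE-ASSEMBLY.v0` §1 (BRIDGE-v), restricted-product half): with `ι := Fin (n+n)`
this is `X□(𝔸_F) ≃ X□(F_v) × X□(𝔸_F^{(v)})` and supplies the `Y := trivialAt` of ★ `Weil1965/SplitPlaceClosure`.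
HC_CM is proved only modulo the printed citations until rung 0 closes.

## References
* D. Bump, *Automorphic Forms and Representations* (1997), §3.3, p. 293 and Prop. 3.3.2 [Bump1997].
* J. W. S. Cassels, A. Fröhlich (eds.), *Algebraic Number Theory* (1967), Ch. II §14 (restricted topological
  products), Ch. XV (Tate) §3.3 [CasselsFrohlichANT1967].
* A. Weil, *Sur la formule de Siegel dans la théorie des groupes classiques*, Acta Math. 113 (1965), n° 51 [Weil1965].
-/

noncomputable section

open MeasureTheory Measure Set Filter Topology IsDedekindDomain NumberField
open scoped ENNReal NNReal Matrix

namespace Literature.NumberTheory.Automorphic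

namespace AdelicVector

section Defs

variable (K : Type) [Field K] [NumberField K] (ι : Type) (v : HeightOneSpectrum (𝓞 K))

/-- The projection `X(𝔸_K) → X(K_v)` onto the `v`-components, `x ↦ ((x i)_v)_i` (coordinatewise the tree's
`AdelicGroupData.adeleEval K v : 𝔸_K →+* K_v`; Bump (1997) §3.3). [cite: Bump1997, §3.3 Prop. 3.3.2] -/
def evalAt : (ι → AdeleRing (𝓞 K) K) →+ (ι → v.adicCompletion K) :=
  (AdelicGroupData.adeleEval K v).toAddMonoidHom.compLeft ι

/-- The factor inclusion `X(K_v) → X(𝔸_K)`, `a ↦ (ι_v(a i))_i` with `ι_v = adeleSingleHom K v` (value `a i`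
at `v`, `0` at every other place and at infinity; Cassels–Fröhlich Ch. II §14). [cite: CasselsFrohlichANT1967, Ch. II §14] -/
def single : (ι → v.adicCompletion K) →+ (ι → AdeleRing (𝓞 K) K) :=
  (adeleSingleHom K v : v.adicCompletion K →+ AdeleRing (𝓞 K) K).compLeft ι

/-- The subgroup `X(𝔸_K)^{(v)}` of vectors TRIVIAL AT `v` (`(x i)_v = 0` for all `i`): the kernel of
`evalAt` — the internal model of the prime-to-`v` factor `X(𝔸_K^{(v)})` (Bump (1997) §3.3: `𝔸 = F_v × 𝔸^v`).
[cite: Bump1997, §3.3 Prop. 3.3.2] -/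
def trivialAt : AddSubgroup (ι → AdeleRing (𝓞 K) K) :=
  (evalAt K ι v).ker

variable {K ι v}

/-- `evalAt x i = (x i)_v` (definitional). [cite: CasselsFrohlichANT1967, Ch. II §14] -/
@[simp]
theorem evalAt_apply (x : ι → AdeleRing (𝓞 K) K) (i : ι) : evalAt K ι v x i = (x i).2 v := rfl

/-- `single a i = adeleSingleHom K v (a i)` (definitional). [cite: CasselsFrohlichANT1967, Ch. II §14] -/
@[simp]
theorem single_apply (a : ι → v.adicCompletion K) (i : ι) : single K ι v a i = adeleSingleHom K v (a i) := rfl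

/-- Membership in `trivialAt`: all `v`-components vanish. [cite: CasselsFrohlichANT1967, Ch. II §14] -/
theorem mem_trivialAt_iff {x : ι → AdeleRing (𝓞 K) K} : x ∈ trivialAt K ι v ↔ ∀ i, (x i).2 v = 0 := by
  rw [trivialAt, AddMonoidHom.mem_ker]
  exact ⟨fun h i => by simpa using congrFun h i, fun h => funext fun i => by simpa using h i⟩

/-- `evalAt` vanishes on `trivialAt`. [cite: CasselsFrohlichANT1967, Ch. II §14] -/
theorem evalAt_eq_zero_of_mem {x : ι → AdeleRing (𝓞 K) K} (hx : x ∈ trivialAt K ι v) : evalAt K ι v x = 0 :=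
  (AddMonoidHom.mem_ker).1 hx

variable (K ι v)

/-- `evalAt` is continuous. [cite: CasselsFrohlichANT1967, Ch. II §14] -/
theorem continuous_evalAt : Continuous (evalAt K ι v) :=
  continuous_pi fun i => (AdelicGroupData.continuous_adeleEval K v).comp (continuous_apply i)

/-- `single` is continuous (`continuous_adeleSingleHom`). [cite: CasselsFrohlichANT1967, Ch. II §14] -/
theorem continuous_single : Continuous (single K ι v) :=
  continuous_pi fun i => (continuous_adeleSingleHom K v).comp (continuous_apply i)

variable {K ι v}

/-- `evalAt (single a) = a`: `single` is a section of the projection. [cite: CasselsFrohlichANT1967, Ch. II §14] -/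
@[simp]
theorem evalAt_single (a : ι → v.adicCompletion K) : evalAt K ι v (single K ι v a) = a := by
  funext i
  exact adeleEval_adeleSingleHom K v (a i)

/-- `single_v a` has `w`-components `0` for every finite place `w ≠ v`. [cite: CasselsFrohlichANT1967, Ch. II §14] -/
theorem evalAt_single_of_ne {w : HeightOneSpectrum (𝓞 K)} (hw : w ≠ v) (a : ι → v.adicCompletion K) :
    evalAt K ι w (single K ι v a) = 0 := by
  funext i
  exact adeleEval_adeleSingleHom_of_ne K v (a i) hw

/-- The archimedean components of `single a` vanish. [cite: CasselsFrohlichANT1967, Ch. II §14] -/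
@[simp]
theorem fst_single_apply (a : ι → v.adicCompletion K) (i : ι) : (single K ι v a i).1 = 0 := rfl

/-- `single` is injective. [cite: CasselsFrohlichANT1967, Ch. II §14] -/
theorem single_injective : Function.Injective (single K ι v) := fun a b h => by
  rw [← evalAt_single (K := K) (ι := ι) (v := v) a, h, evalAt_single]

/-- `x − single (evalAt x)` is trivial at `v`. [cite: CasselsFrohlichANT1967, Ch. II §14] -/
theorem sub_single_evalAt_mem (x : ι → AdeleRing (𝓞 K) K) : x - single K ι v (evalAt K ι v x) ∈ trivialAt K ι v := by
  rw [trivialAt, AddMonoidHom.mem_ker, map_sub, evalAt_single, sub_self]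

/-- `trivialAt` is closed (the kernel of the continuous `evalAt`). [cite: CasselsFrohlichANT1967, Ch. II §14] -/
theorem isClosed_trivialAt : IsClosed ((trivialAt K ι v : AddSubgroup (ι → AdeleRing (𝓞 K) K)) :
    Set (ι → AdeleRing (𝓞 K) K)) := by
  have : ((trivialAt K ι v : AddSubgroup (ι → AdeleRing (𝓞 K) K)) : Set (ι → AdeleRing (𝓞 K) K)) =
      evalAt K ι v ⁻¹' {0} := by
    ext x
    rw [SetLike.mem_coe, trivialAt, AddMonoidHom.mem_ker, Set.mem_preimage, Set.mem_singleton_iff]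
  rw [this]
  exact isClosed_singleton.preimage (continuous_evalAt K ι v)

variable (K ι v)

/-- **The place splitting** `X(K_v) × X(𝔸_K)^{(v)} ≃ₜ+ X(𝔸_K)`, `(a, h) ↦ single a + h`: the internal direct sum
decomposition of the adelic vector space into its `v`-component and the closed subgroup of vectors trivial at
`v` (inverse `x ↦ (x_v, x − single x_v)`). Bump (1997), §3.3: `𝔸 = F_v × 𝔸^v`; Weil (1965) n° 51: `X_A = X_v × X'`.
[cite: Bump1997, §3.3 Prop. 3.3.2] -/
def placeSplitting : ((ι → v.adicCompletion K) × trivialAt K ι v) ≃ₜ+ (ι → AdeleRing (𝓞 K) K) where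
  toFun p := single K ι v p.1 + (p.2 : ι → AdeleRing (𝓞 K) K)
  invFun x := (evalAt K ι v x, ⟨x - single K ι v (evalAt K ι v x), sub_single_evalAt_mem x⟩)
  left_inv p := by
    rcases p with ⟨a, h⟩
    have hh : evalAt K ι v (h : ι → AdeleRing (𝓞 K) K) = 0 := evalAt_eq_zero_of_mem h.2
    ext1
    · simp only [map_add, evalAt_single, hh, add_zero]
    · ext1
      simp only [map_add, evalAt_single, hh, add_zero, add_sub_cancel_left]
  right_inv x := by
    change single K ι v (evalAt K ι v x) + (x - single K ι v (evalAt K ι v x)) = x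
    abel
  map_add' p q := by
    rcases p with ⟨a, h⟩
    rcases q with ⟨a', h'⟩
    change single K ι v (a + a') + ((h : ι → AdeleRing (𝓞 K) K) + h') =
      single K ι v a + (h : ι → AdeleRing (𝓞 K) K) + (single K ι v a' + h')
    rw [map_add]
    abel
  continuous_toFun := ((continuous_single K ι v).comp continuous_fst).add
    (continuous_subtype_val.comp continuous_snd)
  continuous_invFun := (continuous_evalAt K ι v).prodMk
    ((continuous_id.sub ((continuous_single K ι v).comp (continuous_evalAt K ι v))).subtype_mk _)

variable {K ι v}

/-- `placeSplitting (a, h) = single a + h` (definitional). [cite: Bump1997, §3.3 Prop. 3.3.2] -/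
@[simp]
theorem placeSplitting_apply (p : (ι → v.adicCompletion K) × trivialAt K ι v) :
    placeSplitting K ι v p = single K ι v p.1 + (p.2 : ι → AdeleRing (𝓞 K) K) := rfl

/-- The first component of the inverse is the `v`-component. [cite: Bump1997, §3.3 Prop. 3.3.2] -/
@[simp]
theorem placeSplitting_symm_apply_fst (x : ι → AdeleRing (𝓞 K) K) :
    ((placeSplitting K ι v).symm x).1 = evalAt K ι v x := rfl

/-- The second component of the inverse is `x − single x_v`, the part of `x` away from `v`. [cite: Bump1997, §3.3 Prop. 3.3.2] -/
@[simp]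
theorem placeSplitting_symm_apply_snd (x : ι → AdeleRing (𝓞 K) K) :
    (((placeSplitting K ι v).symm x).2 : ι → AdeleRing (𝓞 K) K) = x - single K ι v (evalAt K ι v x) := rfl

/-- The inverse splitting on a vector already trivial at `v`: `(0, h)`. [cite: Bump1997, §3.3 Prop. 3.3.2] -/
theorem placeSplitting_symm_apply_of_mem {x : ι → AdeleRing (𝓞 K) K} (hx : x ∈ trivialAt K ι v) :
    (placeSplitting K ι v).symm x = (0, ⟨x, hx⟩) := by
  have h0 : evalAt K ι v x = 0 := evalAt_eq_zero_of_mem hx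
  ext1
  · exact h0
  · ext1
    rw [placeSplitting_symm_apply_snd, h0, map_zero, sub_zero]

/-- The inverse splitting on a vector in the image of `single`: `(a, 0)`. [cite: Bump1997, §3.3 Prop. 3.3.2] -/
theorem placeSplitting_symm_single (a : ι → v.adicCompletion K) :
    (placeSplitting K ι v).symm (single K ι v a) = (a, 0) := by
  ext1
  · exact evalAt_single a
  · ext1
    rw [placeSplitting_symm_apply_snd, evalAt_single, sub_self]
    rfl

end Defs

/-! ## §3 Point-set facts (theorems of Mathlib and the tree, bound locally) -/

section PointSet

variable (K : Type) [Field K] [NumberField K] (ι : Type) (v : HeightOneSpectrum (𝓞 K))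

/-- `X(𝔸_K)` is Hausdorff. [cite: CasselsFrohlichANT1967, Ch. II §14] -/
theorem t2Space_pi : T2Space (ι → AdeleRing (𝓞 K) K) := by
  haveI : T2Space (FiniteAdeleRing (𝓞 K) K) := inferInstanceAs <| T2Space
    (RestrictedProduct (fun w : HeightOneSpectrum (𝓞 K) => w.adicCompletion K)
      (fun w => (w.adicCompletionIntegers K : Set (w.adicCompletion K))) Filter.cofinite)
  haveI : T2Space (InfiniteAdeleRing K) := inferInstanceAs <| T2Space ((w : InfinitePlace K) → w.Completion)
  haveI : T2Space (AdeleRing (𝓞 K) K) := inferInstanceAs <| T2Space (InfiniteAdeleRing K × FiniteAdeleRing (𝓞 K) K)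
  infer_instance

variable [Finite ι]

/-- `X(𝔸_K)` is second countable. [cite: CasselsFrohlichANT1967, Ch. II §14] -/
theorem secondCountableTopology_pi : SecondCountableTopology (ι → AdeleRing (𝓞 K) K) := by
  haveI := secondCountableTopology_adeleRing (K := K)
  haveI : Countable ι := Finite.to_countable
  infer_instance

/-- `X(𝔸_K)` is locally compact. [cite: CasselsFrohlichANT1967, Ch. II §14] -/
theorem locallyCompactSpace_pi : LocallyCompactSpace (ι → AdeleRing (𝓞 K) K) := by
  haveI := locallyCompactSpace_adeleRing' (K := K)
  infer_instance

/-- `X(K_v)` is second countable. [cite: CasselsFrohlichANT1967, Ch. II §14] -/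
theorem secondCountableTopology_piLocal : SecondCountableTopology (ι → v.adicCompletion K) := by
  haveI := secondCountableTopology_adicCompletion K v
  haveI : Countable ι := Finite.to_countable
  infer_instance

/-- `trivialAt` is second countable. [cite: CasselsFrohlichANT1967, Ch. II §14] -/
theorem secondCountableTopology_trivialAt : SecondCountableTopology (trivialAt K ι v) := by
  haveI := secondCountableTopology_pi K ι
  exact TopologicalSpace.Subtype.secondCountableTopology _

/-- `trivialAt` is locally compact (a closed subgroup of the locally compact `X(𝔸_K)`). [cite: CasselsFrohlichANT1967, Ch. II §14] -/
theorem locallyCompactSpace_trivialAt : LocallyCompactSpace (trivialAt K ι v) := by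
  haveI := locallyCompactSpace_pi K ι
  exact (isClosed_trivialAt (K := K) (ι := ι) (v := v)).isClosedEmbedding_subtypeVal.locallyCompactSpace

end PointSet

/-! ## §4 Factorisation of the Haar measure -/

section Haar

variable {K : Type} [Field K] [NumberField K] {ι : Type} [Fintype ι] {v : HeightOneSpectrum (𝓞 K)}
  [MeasurableSpace (AdeleRing (𝓞 K) K)] [BorelSpace (AdeleRing (𝓞 K) K)]
  [MeasurableSpace (v.adicCompletion K)] [BorelSpace (v.adicCompletion K)]

/-- **Factorisation of the Haar measure along the place splitting**: for additive Haar measures `ν` on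
`X(𝔸_K)`, `μ_v` on `X(K_v)` and `μ'` on `X(𝔸_K)^{(v)} = trivialAt` there is `κ > 0` with
`(placeSplitting⁻¹)_* ν = κ • (μ_v ⊗ μ')` — the product of Haar measures is a Haar measure of the product group,
and Haar measure is unique up to a positive scalar (Bump (1997), Prop. 3.3.2: "the Haar measure on `GL(n, 𝔸)` is
the product of the Haar measures"; here for the additive group `𝔸^ι`). [cite: Bump1997, §3.3 Prop. 3.3.2] -/
theorem exists_map_placeSplitting_symm_eq_smul_prod
    (ν : Measure (ι → AdeleRing (𝓞 K) K)) [ν.IsAddHaarMeasure]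
    (μv : Measure (ι → v.adicCompletion K)) [μv.IsAddHaarMeasure]
    (μ' : Measure (trivialAt K ι v)) [μ'.IsAddHaarMeasure] :
    ∃ κ : ℝ≥0, 0 < κ ∧ Measure.map (placeSplitting K ι v).symm ν = κ • μv.prod μ' := by
  haveI := t2Space_pi K ι
  haveI := secondCountableTopology_pi K ι
  haveI := locallyCompactSpace_pi K ι
  haveI := secondCountableTopology_piLocal K ι v
  haveI := secondCountableTopology_trivialAt K ι v
  haveI := locallyCompactSpace_trivialAt K ι v
  haveI := secondCountableTopology_adeleRing (K := K)
  haveI := secondCountableTopology_adicCompletion K v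
  haveI : Countable ι := Finite.to_countable
  haveI : BorelSpace (ι → AdeleRing (𝓞 K) K) := Pi.borelSpace
  haveI : BorelSpace (ι → v.adicCompletion K) := Pi.borelSpace
  haveI : BorelSpace (trivialAt K ι v) := Subtype.borelSpace _
  haveI : BorelSpace ((ι → v.adicCompletion K) × trivialAt K ι v) := Prod.borelSpace
  haveI : SigmaCompactSpace (trivialAt K ι v) := sigmaCompactSpace_of_locallyCompact_secondCountable
  haveI : SigmaCompactSpace (ι → v.adicCompletion K) := sigmaCompactSpace_of_locallyCompact_secondCountable
  haveI : SFinite μ' := inferInstance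
  haveI : SFinite μv := inferInstance
  set e := (placeSplitting K ι v).symm with he
  haveI : (μv.prod μ').IsAddHaarMeasure := inferInstance
  haveI : (Measure.map e ν).IsAddHaarMeasure := e.toAddEquiv.isAddHaarMeasure_map ν e.continuous e.symm.continuous
  refine ⟨(Measure.map e ν).addHaarScalarFactor (μv.prod μ'),
    addHaarScalarFactor_pos_of_isAddHaarMeasure _ _, ?_⟩
  exact isAddLeftInvariant_eq_smul (Measure.map e ν) (μv.prod μ')

/-- **`∫⁻ F dν = κ ∫⁻ ∫⁻ F(single a + h) dμ_v(a) dμ'(h)`** for every measurable `F ≥ 0` (transport along the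
splitting and Tonelli). [cite: Bump1997, §3.3 Prop. 3.3.2] -/
theorem exists_lintegral_eq_mul_lintegral_lintegral
    (ν : Measure (ι → AdeleRing (𝓞 K) K)) [ν.IsAddHaarMeasure]
    (μv : Measure (ι → v.adicCompletion K)) [μv.IsAddHaarMeasure]
    (μ' : Measure (trivialAt K ι v)) [μ'.IsAddHaarMeasure] :
    ∃ κ : ℝ≥0, 0 < κ ∧ ∀ F : (ι → AdeleRing (𝓞 K) K) → ℝ≥0∞, Measurable F →
      ∫⁻ x, F x ∂ν = κ * ∫⁻ h, ∫⁻ a, F (single K ι v a + (h : ι → AdeleRing (𝓞 K) K)) ∂μv ∂μ' := by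
  haveI := t2Space_pi K ι
  haveI := secondCountableTopology_pi K ι
  haveI := secondCountableTopology_piLocal K ι v
  haveI := secondCountableTopology_trivialAt K ι v
  haveI := locallyCompactSpace_trivialAt K ι v
  haveI := secondCountableTopology_adeleRing (K := K)
  haveI := secondCountableTopology_adicCompletion K v
  haveI : Countable ι := Finite.to_countable
  haveI : BorelSpace (ι → AdeleRing (𝓞 K) K) := Pi.borelSpace
  haveI : BorelSpace (ι → v.adicCompletion K) := Pi.borelSpace
  haveI : BorelSpace (trivialAt K ι v) := Subtype.borelSpace _
  haveI : BorelSpace ((ι → v.adicCompletion K) × trivialAt K ι v) := Prod.borelSpace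
  haveI : SigmaCompactSpace (trivialAt K ι v) := sigmaCompactSpace_of_locallyCompact_secondCountable
  haveI : SFinite μ' := inferInstance
  obtain ⟨κ, hκ, hmap⟩ := exists_map_placeSplitting_symm_eq_smul_prod (K := K) (ι := ι) (v := v) ν μv μ'
  refine ⟨κ, hκ, fun F hF => ?_⟩
  set e := (placeSplitting K ι v).symm with he
  set em : (ι → AdeleRing (𝓞 K) K) ≃ᵐ (ι → v.adicCompletion K) × trivialAt K ι v :=
    e.toHomeomorph.toMeasurableEquiv with hem
  have hem' : (em : _ → _) = e := rfl
  have hG : Measurable fun p : (ι → v.adicCompletion K) × trivialAt K ι v => F (e.symm p) :=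
    hF.comp e.symm.continuous.measurable
  have h1 : ∫⁻ x, F x ∂ν = ∫⁻ p, F (e.symm p) ∂(Measure.map e ν) := by
    rw [← hem', lintegral_map_equiv]
    simp only [hem', ContinuousAddEquiv.symm_apply_apply]
  rw [h1, hmap, lintegral_smul_measure, lintegral_prod_symm _ hG.aemeasurable]
  congr 1

/-- **Bochner form: `∫ F dν = κ • ∫ F(single a + h) d(μ_v ⊗ μ')(a, h)`** for every `F` (no integrability
needed: both sides vanish together), with the same `κ` for all integrands; combine with Fubini
(`MeasureTheory.integral_prod`) for integrable `F`. [cite: Bump1997, §3.3 Prop. 3.3.2] -/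
theorem exists_integral_eq_smul_integral_prod
    (ν : Measure (ι → AdeleRing (𝓞 K) K)) [ν.IsAddHaarMeasure]
    (μv : Measure (ι → v.adicCompletion K)) [μv.IsAddHaarMeasure]
    (μ' : Measure (trivialAt K ι v)) [μ'.IsAddHaarMeasure]
    {E : Type*} [NormedAddCommGroup E] [NormedSpace ℝ E] :
    ∃ κ : ℝ≥0, 0 < κ ∧ ∀ F : (ι → AdeleRing (𝓞 K) K) → E,
      ∫ x, F x ∂ν = (κ : ℝ) • ∫ p : (ι → v.adicCompletion K) × trivialAt K ι v,
        F (single K ι v p.1 + (p.2 : ι → AdeleRing (𝓞 K) K)) ∂(μv.prod μ') := by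
  haveI := t2Space_pi K ι
  haveI := secondCountableTopology_pi K ι
  haveI := secondCountableTopology_piLocal K ι v
  haveI := secondCountableTopology_trivialAt K ι v
  haveI := secondCountableTopology_adeleRing (K := K)
  haveI := secondCountableTopology_adicCompletion K v
  haveI : Countable ι := Finite.to_countable
  haveI : BorelSpace (ι → AdeleRing (𝓞 K) K) := Pi.borelSpace
  haveI : BorelSpace (ι → v.adicCompletion K) := Pi.borelSpace
  haveI : BorelSpace (trivialAt K ι v) := Subtype.borelSpace _
  haveI : BorelSpace ((ι → v.adicCompletion K) × trivialAt K ι v) := Prod.borelSpace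
  obtain ⟨κ, hκ, hmap⟩ := exists_map_placeSplitting_symm_eq_smul_prod (K := K) (ι := ι) (v := v) ν μv μ'
  refine ⟨κ, hκ, fun F => ?_⟩
  set e := (placeSplitting K ι v).symm with he
  set em : (ι → AdeleRing (𝓞 K) K) ≃ᵐ (ι → v.adicCompletion K) × trivialAt K ι v :=
    e.toHomeomorph.toMeasurableEquiv with hem
  have hem' : (em : _ → _) = e := rfl
  have h1 : ∫ x, F x ∂ν = ∫ p, F (e.symm p) ∂(Measure.map e ν) := by
    rw [← hem', integral_map_equiv]
    simp only [hem', ContinuousAddEquiv.symm_apply_apply]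
  rw [h1, hmap, integral_smul_nnreal_measure]
  rfl

/-- A measure on `X(𝔸_K)` finite on compact sets stays finite on compact sets when transported along the
splitting (a homeomorphism). [cite: Bump1997, §3.3 Prop. 3.3.2] -/
theorem isFiniteMeasureOnCompacts_map_placeSplitting_symm
    (μ : Measure (ι → AdeleRing (𝓞 K) K)) [IsFiniteMeasureOnCompacts μ] :
    IsFiniteMeasureOnCompacts (Measure.map (placeSplitting K ι v).symm μ) := by
  haveI := t2Space_pi K ι
  haveI := secondCountableTopology_pi K ι
  haveI := secondCountableTopology_piLocal K ι v
  haveI := secondCountableTopology_trivialAt K ι v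
  haveI := secondCountableTopology_adeleRing (K := K)
  haveI := secondCountableTopology_adicCompletion K v
  haveI : Countable ι := Finite.to_countable
  haveI : BorelSpace (ι → AdeleRing (𝓞 K) K) := Pi.borelSpace
  haveI : BorelSpace (ι → v.adicCompletion K) := Pi.borelSpace
  haveI : BorelSpace (trivialAt K ι v) := Subtype.borelSpace _
  haveI : BorelSpace ((ι → v.adicCompletion K) × trivialAt K ι v) := Prod.borelSpace
  exact IsFiniteMeasureOnCompacts.map μ (placeSplitting K ι v).symm.toHomeomorph

end Haar

/-! ## §5 Matrix actions: `𝔸_K`-linear maps act coordinatewise; a matrix local at `v` acts as `(A_v *ᵥ ·) × id` -/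

section Matrix

variable {K : Type} [Field K] [NumberField K] {ι : Type} [Fintype ι] {v : HeightOneSpectrum (𝓞 K)}

/-- **`(A *ᵥ x)_v = A_v *ᵥ x_v`**: the `v`-component of the action of an adelic matrix is the action of its
`v`-component `A_v = A.map (adeleEval K v)` (Bump (1997) §3.3: `GL(n, 𝔸)` acts componentwise). [cite: Bump1997, §3.3 Prop. 3.3.2] -/
theorem evalAt_mulVec (A : Matrix ι ι (AdeleRing (𝓞 K) K)) (x : ι → AdeleRing (𝓞 K) K) :
    evalAt K ι v (A *ᵥ x) = (A.map (AdelicGroupData.adeleEval K v)) *ᵥ evalAt K ι v x := by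
  funext i
  change AdelicGroupData.adeleEval K v ((A *ᵥ x) i) = _
  rw [RingHom.map_mulVec]
  rfl

/-- `trivialAt` is stable under every adelic matrix. [cite: CasselsFrohlichANT1967, Ch. II §14] -/
theorem mulVec_mem_trivialAt (A : Matrix ι ι (AdeleRing (𝓞 K) K)) {x : ι → AdeleRing (𝓞 K) K}
    (hx : x ∈ trivialAt K ι v) : A *ᵥ x ∈ trivialAt K ι v := by
  rw [trivialAt, AddMonoidHom.mem_ker, evalAt_mulVec, evalAt_eq_zero_of_mem hx, Matrix.mulVec_zero]

/-- Two adeles with the same archimedean part and the same components at every finite place are equal. [cite: CasselsFrohlichANT1967, Ch. II §14] -/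
theorem adele_ext {a b : AdeleRing (𝓞 K) K} (h1 : a.1 = b.1)
    (h2 : ∀ w : HeightOneSpectrum (𝓞 K), a.2 w = b.2 w) : a = b :=
  Prod.ext h1 (RestrictedProduct.ext _ _ h2)

/-- components of a sum of adeles at a finite place (definitional). [folklore] -/
private theorem adele_snd_add_apply (x y : AdeleRing (𝓞 K) K) (w : HeightOneSpectrum (𝓞 K)) :
    (x + y).2 w = x.2 w + y.2 w := rfl

/-- archimedean part of a sum of adeles (definitional). [folklore] -/
private theorem adele_fst_add (x y : AdeleRing (𝓞 K) K) : (x + y).1 = x.1 + y.1 := rfl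

variable [DecidableEq ι]

/-- The archimedean part of `A *ᵥ y` is `y_∞` when the archimedean part of `A` is the identity. [cite: CasselsFrohlichANT1967, Ch. II §14] -/
theorem fst_mulVec_apply_of_fst_eq_one (A : Matrix ι ι (AdeleRing (𝓞 K) K))
    (h1 : ∀ i j, (A i j).1 = (1 : Matrix ι ι (InfiniteAdeleRing K)) i j)
    (y : ι → AdeleRing (𝓞 K) K) (i : ι) : ((A *ᵥ y) i).1 = (y i).1 := by
  let f : AdeleRing (𝓞 K) K →+* InfiniteAdeleRing K := RingHom.fst (InfiniteAdeleRing K) (FiniteAdeleRing (𝓞 K) K)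
  have hA : A.map f = 1 := by
    ext j k
    exact h1 j k
  calc ((A *ᵥ y) i).1 = f ((A *ᵥ y) i) := rfl
    _ = ((A.map f) *ᵥ (f ∘ y)) i := by rw [RingHom.map_mulVec]
    _ = (y i).1 := by rw [hA, Matrix.one_mulVec]; rfl

/-- **A matrix LOCAL AT `v` acts on `single a + h` as `single (A_v *ᵥ a) + h`**: if the archimedean part of `A` is
the identity (`(A i j).1 = δ_{ij}`) and its `w`-component is the identity for every finite `w ≠ v`, then `A` moves
only the `v`-coordinates (Bump (1997) §3.3; Weil (1965) n° 51: the `v`-member acts on the factor `X_v` of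
`X_A = X_v × X'`). [cite: Bump1997, §3.3 Prop. 3.3.2] -/
theorem mulVec_single_add_of_isLocalAt (A : Matrix ι ι (AdeleRing (𝓞 K) K))
    (h1 : ∀ i j, (A i j).1 = (1 : Matrix ι ι (InfiniteAdeleRing K)) i j)
    (hw : ∀ w : HeightOneSpectrum (𝓞 K), w ≠ v →
      A.map (AdelicGroupData.adeleEval K w) = (1 : Matrix ι ι (w.adicCompletion K)))
    (a : ι → v.adicCompletion K) {h : ι → AdeleRing (𝓞 K) K} (hh : h ∈ trivialAt K ι v) :
    A *ᵥ (single K ι v a + h) = single K ι v ((A.map (AdelicGroupData.adeleEval K v)) *ᵥ a) + h := by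
  funext i
  refine adele_ext ?_ fun w => ?_
  · -- archimedean components: `A_∞ = 1`, `(single a)_∞ = 0`
    rw [fst_mulVec_apply_of_fst_eq_one A h1]
    change (single K ι v a i + h i).1 = (single K ι v _ i + h i).1
    rw [adele_fst_add, adele_fst_add, fst_single_apply, fst_single_apply]
  · -- finite components: at `v` the matrix `A_v`, elsewhere the identity
    have hsnd : ∀ y : ι → AdeleRing (𝓞 K) K, ((A *ᵥ y) i).2 w =
        ((A.map (AdelicGroupData.adeleEval K w)) *ᵥ evalAt K ι w y) i := fun y =>
      congrFun (evalAt_mulVec (v := w) A y) i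
    rw [hsnd]
    by_cases hwv : w = v
    · subst hwv
      rw [map_add, evalAt_single, evalAt_eq_zero_of_mem hh, add_zero]
      change _ = (single K ι w (A.map (AdelicGroupData.adeleEval K w) *ᵥ a) i + h i).2 w
      rw [adele_snd_add_apply, single_apply, adeleSingleHom_apply_snd, finiteAdeleSingleHom_apply_self,
        (mem_trivialAt_iff.1 hh) i, add_zero]
    · rw [hw w hwv, Matrix.one_mulVec, map_add, evalAt_single_of_ne hwv, zero_add, evalAt_apply]
      change (h i).2 w = (single K ι v (A.map (AdelicGroupData.adeleEval K v) *ᵥ a) i + h i).2 w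
      rw [adele_snd_add_apply, single_apply, adeleSingleHom_apply_snd,
        finiteAdeleSingleHom_apply_of_ne K v _ hwv, zero_add]

/-- **Through the splitting, a matrix local at `v` acts as `(A_v *ᵥ ·) × id`**:
`placeSplitting⁻¹ (A *ᵥ x) = (A_v *ᵥ (placeSplitting⁻¹ x).1, (placeSplitting⁻¹ x).2)`. [cite: Bump1997, §3.3 Prop. 3.3.2] -/
theorem placeSplitting_symm_mulVec_of_isLocalAt (A : Matrix ι ι (AdeleRing (𝓞 K) K))
    (h1 : ∀ i j, (A i j).1 = (1 : Matrix ι ι (InfiniteAdeleRing K)) i j)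
    (hw : ∀ w : HeightOneSpectrum (𝓞 K), w ≠ v →
      A.map (AdelicGroupData.adeleEval K w) = (1 : Matrix ι ι (w.adicCompletion K)))
    (x : ι → AdeleRing (𝓞 K) K) :
    (placeSplitting K ι v).symm (A *ᵥ x) =
      ((A.map (AdelicGroupData.adeleEval K v)) *ᵥ ((placeSplitting K ι v).symm x).1,
        ((placeSplitting K ι v).symm x).2) := by
  set p := (placeSplitting K ι v).symm x with hp
  have hx : x = single K ι v p.1 + (p.2 : ι → AdeleRing (𝓞 K) K) := by
    rw [← placeSplitting_apply, hp, ContinuousAddEquiv.apply_symm_apply]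
  rw [hx, mulVec_single_add_of_isLocalAt A h1 hw p.1 p.2.2]
  apply (placeSplitting K ι v).injective
  rw [ContinuousAddEquiv.apply_symm_apply, placeSplitting_apply]

/-- The same for the tree's local embedding `GLn.ofLocal m K v g` of `GL_m(K_v)` (its archimedean part and its
`w`-components, `w ≠ v`, are the identity: `GLn.fst_coe_ofLocal_apply`, `GLn.toLocal_ofLocal_of_ne`):
`placeSplitting⁻¹ (ι_v(g) *ᵥ x) = (g *ᵥ (placeSplitting⁻¹ x).1, (placeSplitting⁻¹ x).2)`. [cite: Bump1997, §3.3 Prop. 3.3.2] -/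
theorem placeSplitting_symm_ofLocal_mulVec {m : ℕ} (g : GL (Fin m) (v.adicCompletion K))
    (x : Fin m → AdeleRing (𝓞 K) K) :
    (placeSplitting K (Fin m) v).symm ((GLn.ofLocal m K v g : Matrix (Fin m) (Fin m) (AdeleRing (𝓞 K) K)) *ᵥ x) =
      ((g : Matrix (Fin m) (Fin m) (v.adicCompletion K)) *ᵥ ((placeSplitting K (Fin m) v).symm x).1,
        ((placeSplitting K (Fin m) v).symm x).2) := by
  have hv : (GLn.ofLocal m K v g : Matrix (Fin m) (Fin m) (AdeleRing (𝓞 K) K)).map (AdelicGroupData.adeleEval K v) =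
      (g : Matrix (Fin m) (Fin m) (v.adicCompletion K)) := by
    have := GLn.toLocal_ofLocal (n := m) (K := K) (v := v) g
    rw [AdelicGroupData.gl_toLocal] at this
    exact congrArg (fun u : GL (Fin m) (v.adicCompletion K) => (u : Matrix (Fin m) (Fin m) (v.adicCompletion K))) this
  have hw : ∀ w : HeightOneSpectrum (𝓞 K), w ≠ v →
      (GLn.ofLocal m K v g : Matrix (Fin m) (Fin m) (AdeleRing (𝓞 K) K)).map (AdelicGroupData.adeleEval K w) = 1 := by
    intro w hwv
    have := GLn.toLocal_ofLocal_of_ne (n := m) (K := K) hwv g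
    rw [AdelicGroupData.gl_toLocal] at this
    exact congrArg (fun u : GL (Fin m) (w.adicCompletion K) => (u : Matrix (Fin m) (Fin m) (w.adicCompletion K))) this
  rw [placeSplitting_symm_mulVec_of_isLocalAt _ (fun i j => GLn.fst_coe_ofLocal_apply g i j) hw, hv]

end Matrix

end AdelicVector

end Literature.NumberTheory.Automorphic
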